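import Summits.ResolutionOfSingularities.KangarooAtlas.MizutaniProjectiveOrderPoint
import Literature.AlgebraicGeometry.Resolution.ProjectiveSpaceRegular
import Mathlib.AlgebraicGeometry.ProjectiveSpectrum.Scheme
import Mathlib.RingTheory.RegularLocalRing.Polynomial
import HarnessLib

/-!
# Mizutani's conjecture — the local ring `𝒪_{ℙⁿ,𝔭}` of a point of projective space is a regular local ring

Cell topic `Summits/ResolutionOfSingularities/KangarooAtlas` (pub-rosobs); namespace
`Summit.ResolutionOfSingularities.KangarooAtlas.Mizutani`.  Companion to the Lean transcription of the in-house
note MIZUTANI-PROOF-g59 (AI-written, AI-audited; *AI review is weaker than expert review*; not a resolution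
theorem).

`MizutaniProjectiveOrder(Point).lean` read «`mult_𝔭 φ ≥ d`» as the order condition `ν(φ/X_i^d) ≥ d` in the
projective local ring `𝒪_{Proj S,𝔭} = HomogeneousLocalization.AtPrime (homogeneousSubmodule (Fin (n+1)) k) 𝔭`
([H4] Hironaka 1970 p. 154).  The word «multiplicity» (Mizutani 1973 p. 85: `mult_p(Proj(S/fS))`) refers to a
hypersurface in the SMOOTH scheme `ℙⁿ_k`, whose local rings are REGULAR; in a regular local ring the multiplicity of
the hypersurface `f = 0` is the order of `f`.  This file records the regularity in the form the cell uses (no new mathematics: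
the tree's `ProjectiveSpaceRegular.lean` already proves that `ℙⁿ_k` is a regular scheme):

* `toProjectiveSpectrum` — a point `𝔭` of `ℙⁿ_k` in the tree's sense (`IsPoint`: homogeneous prime `⊉ S_+`) as a point
  of Mathlib's `ProjectiveSpectrum`, lying in the basic open `D_+(X_i)` for any `X_i ∉ 𝔭`;
* **`isRegularLocalRing_projLocalRing`** — `𝒪_{Proj S,𝔭}` is a regular local ring for every point `𝔭` of `ℙⁿ_k`.
  This is the `HomogeneousLocalization.AtPrime` / `IsPoint` REFORMULATION (the form the cell's `projGerm` files
  use) of a fact the tree already holds in stalk form: `Literature.AlgebraicGeometry.Resolution.isRegular_projectiveSpace`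
  (`ProjectiveSpaceRegular.lean`: `Scheme.IsRegular (projectiveSpace n k).left`), whose chart input
  `isRegularRing_chart` (the chart ring `(k[X]_{X_i})_0 ≅ k[y_1, …, y_n]` is a regular ring) is reused here; the
  localisation step is Mathlib's `AlgebraicGeometry.ProjectiveSpectrum.Proj.isLocalization_atPrime` (`𝒪_{Proj S,𝔭}`
  is a localisation of the chart ring at a prime, Hartshorne II Prop. 2.5 (b)).

References: [Hartshorne1977] I Thm. 3.4 (proof), II Prop. 2.5; [Hironaka1970NumericalCharacters] p. 154;
[Mizutani1973HironakaGroupSchemes] p. 85 L21–29.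
-/

noncomputable section

open MvPolynomial DirectSum AlgebraicGeometry Literature.AlgebraicGeometry.Resolution
  Literature.AlgebraicGeometry.Resolution.HironakaScheme

attribute [local instance] MvPolynomial.gradedAlgebra

namespace Summit.ResolutionOfSingularities.KangarooAtlas.Mizutani

universe u

section Regular

variable {k : Type u} [Field k] {n : ℕ}

variable (𝔭 : Ideal (MvPolynomial (Fin (n + 1)) k)) [h𝔭 : 𝔭.IsPrime]

/-- A point of `ℙⁿ_k` in the tree's sense (`IsPoint k 𝔭`: a homogeneous prime not containing `S_+`) as a point of
Mathlib's `ProjectiveSpectrum` of the graded ring `S = k[X_0, …, X_n]` (a relevant homogeneous prime).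
[cite: Oda1983HironakaGroupSchemeII, §2 (p. 1168: "a homogeneous prime ideal 𝔭 of S with 𝔭 ≠ S_+")] -/
def toProjectiveSpectrum (hP : IsPoint k 𝔭) :
    ProjectiveSpectrum (homogeneousSubmodule (Fin (n + 1)) k) where
  asHomogeneousIdeal := { toSubmodule := 𝔭, is_homogeneous' := isHomogeneous_of_isPoint 𝔭 hP }
  isPrime := h𝔭
  not_irrelevant_le := by
    intro hle
    refine hP.2.2 (irrelevant_le_of_X_mem k fun j => ?_)
    have hX : (X j : MvPolynomial (Fin (n + 1)) k) ∈
        HomogeneousIdeal.irrelevant (homogeneousSubmodule (Fin (n + 1)) k) :=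
      HomogeneousIdeal.mem_irrelevant_of_mem _ Nat.one_pos (isHomogeneous_X k j)
    exact hle hX

/-- The underlying ideal of `toProjectiveSpectrum 𝔭` is `𝔭` (unfolding). [folklore] -/
@[simp] theorem toProjectiveSpectrum_asHomogeneousIdeal_toIdeal (hP : IsPoint k 𝔭) :
    (toProjectiveSpectrum 𝔭 hP).asHomogeneousIdeal.toIdeal = 𝔭 :=
  rfl

/-- For `X_i ∉ 𝔭` the point lies in the basic open set `D_+(X_i)` of `Proj S`. [folklore] -/
theorem toProjectiveSpectrum_mem_basicOpen (hP : IsPoint k 𝔭) {i : Fin (n + 1)}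
    (hi : (X i : MvPolynomial (Fin (n + 1)) k) ∉ 𝔭) :
    toProjectiveSpectrum 𝔭 hP ∈
      ProjectiveSpectrum.basicOpen (homogeneousSubmodule (Fin (n + 1)) k) (X i : MvPolynomial (Fin (n + 1)) k) :=
  hi

/-- **`𝒪_{ℙⁿ,𝔭}` is a regular local ring** for every point `𝔭` of `ℙⁿ_k` (any field `k`): the projective local
ring `𝒪_{Proj S,𝔭} = HomogeneousLocalization.AtPrime (homogeneousSubmodule (Fin (n+1)) k) 𝔭` is, for a variable
`X_i ∉ 𝔭`, the localisation of the chart ring `(S_{X_i})_0 ≅ k[y_1, …, y_n]` at a prime (Mathlib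
`Proj.isLocalization_atPrime`), and that chart ring is regular (`Literature.AlgebraicGeometry.Resolution.isRegularRing_chart`;
the stalk form `Scheme.IsRegular ℙⁿ_k` is the tree's `isRegular_projectiveSpace`, `ProjectiveSpaceRegular.lean` — this
theorem is its `AtPrime`/`IsPoint` reformulation, not a new result).  This is the regularity of the ambient local
ring in which Hironaka's `ν_{x'}` ([H4] p. 154) and Mizutani's `mult_p` (p. 85) are taken.
[cite: Hartshorne1977, II Prop. 2.5 (b) (proof: stalks of Proj S are localisations of the rings S_(f))] -/
theorem isRegularLocalRing_projLocalRing (hP : IsPoint k 𝔭) :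
    IsRegularLocalRing (HomogeneousLocalization.AtPrime (homogeneousSubmodule (Fin (n + 1)) k) 𝔭) := by
  obtain ⟨i, hi⟩ := exists_X_not_mem_of_isPoint 𝔭 hP
  haveI := Literature.AlgebraicGeometry.Resolution.isRegularRing_chart n k i
  -- the point of `Proj S` and the algebra structure `(S_{X_i})_0 → 𝒪_{Proj S,𝔭}`
  let x : ↥(ProjectiveSpectrum.basicOpen (homogeneousSubmodule (Fin (n + 1)) k)
      (X i : MvPolynomial (Fin (n + 1)) k)) :=
    ⟨toProjectiveSpectrum 𝔭 hP, toProjectiveSpectrum_mem_basicOpen 𝔭 hP hi⟩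
  letI : Algebra
      (HomogeneousLocalization.Away (homogeneousSubmodule (Fin (n + 1)) k) (X i : MvPolynomial (Fin (n + 1)) k))
      (HomogeneousLocalization.AtPrime (homogeneousSubmodule (Fin (n + 1)) k)
        x.1.asHomogeneousIdeal.toIdeal) :=
    (HomogeneousLocalization.mapId (homogeneousSubmodule (Fin (n + 1)) k) (Submonoid.powers_le.mpr x.2)).toAlgebra
  haveI hloc := ProjectiveSpectrum.Proj.isLocalization_atPrime (homogeneousSubmodule (Fin (n + 1)) k)
    (X i : MvPolynomial (Fin (n + 1)) k) x (m := 1) (isHomogeneous_X k i) Nat.one_pos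
  -- `𝒪_{Proj S,𝔭} ≅` the localisation of the regular chart ring at the prime `𝔮` below the closed point
  have e := IsLocalization.algEquiv
    ((ProjectiveSpectrum.Proj.toSpec (homogeneousSubmodule (Fin (n + 1)) k)
      (X i : MvPolynomial (Fin (n + 1)) k)).base x).asIdeal.primeCompl
    (Localization.AtPrime
      ((ProjectiveSpectrum.Proj.toSpec (homogeneousSubmodule (Fin (n + 1)) k)
        (X i : MvPolynomial (Fin (n + 1)) k)).base x).asIdeal)
    (HomogeneousLocalization.AtPrime (homogeneousSubmodule (Fin (n + 1)) k) x.1.asHomogeneousIdeal.toIdeal)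
  exact IsRegularLocalRing.of_ringEquiv e.toRingEquiv

end Regular

end Summit.ResolutionOfSingularities.KangarooAtlas.Mizutani

end
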